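import Mathlib
import HarnessLib
import Summits.HubbardSuperconductivity.HubbardSuperconductivity.Theorems.KLProgrammeKLRegimeCountertermJacksonRemainderCertDefs

/-!
# Route `KLProgramme`, crux K3 — gen-8 ENGINE-FLOW child (stmt-HubbardSuperconductivity-20437 `KLRegimeEngineV17F2`), stub (C)
# `stub_twoLeg_curvature`: the (C1) certificate's NO-RATE linear form `CutoffDefectTable.boundNR` (C⁴ history)

Seat hubbard-kl-k3c3-p1 (g8; row «δμ-flow with klAngularMean constant piece»).  The linear form of record
`CutoffDefectTable.bound T a k` (`…CountertermJacksonRemainderCertDefs`, p554667) charges the top-order transport increment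
`χ_w·(g⁽ᵏ⁾(α_w(θ)) − g⁽ᵏ⁾(θ))` by the RATE row `a_{k+1}·Td` (mean-value theorem), so its consumers ask for the profile's `(k+1)`-st jet —
at `k = 4` a FIFTH jet and `g ∈ C⁵`.  The induction hypothesis of stub (C) (`TwoLegReadJetBound … K_n n`) is `C⁴` with jets `k ≤ 4` only
(c4a-1: «the chain rule along γ caps at order 4»; k3c3-p3 `C1-JETBOX-DEEP.md` §4.2), so the closer needs the NO-RATE alternative
`|g⁽ᵏ⁾(α_w(θ)) − g⁽ᵏ⁾(θ)| ≤ 2a_k` for the top order: with `0 ≤ χ ≤ 1` and `∫J̃J̃ = 1` that row costs exactly `2·a_k`.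

* `CutoffDefectTable.boundNR T a k := a₀·N_k + Σ_{1≤i<k} C(k,i)·Σ_{1≤l≤k−i} a_l·Mc[k,i,l] + Σ_{1≤l<k} a_l·Tt[k,l] + a_k·Tu[k] + 2·a_k + a_k·N0`
  (the `N_k` term only for `k ≥ 1`) — `T.bound a k` with `a_{k+1}·Td` replaced by `2·a_k`; it reads `a l` for `l ≤ k` only;
* `boundNR_eq_bound_sub_add` (the relation to `T.bound`), `door_sum_eq_boundNR` (the door's sum with the no-rate transport moment IS
  `T.boundNR a k`, `1 ≤ k ≤ 4`), `boundNR_nonneg`, `boundNR_mono` (monotone in the sizes `a` for a nonnegative table).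

Definition + bookkeeping only; nothing about the model is asserted; nothing asserts superconductivity.
-/

noncomputable section

namespace Summit.HubbardSuperconductivity.HubbardSuperconductivity.Theorems.KLRegimeSplit

set_option linter.dupNamespace false -- summit = problem name (single-conjunct summit), D-0017

/-- **The certificate's NO-RATE LINEAR FORM** (C⁴ history): the bound of the `k`-th jet of the Jackson remainder for profile jet sizes `a`
(`|g^{(l)}| ≤ a l`, `g = f − mean f`, `l ≤ k`), the top-order transport increment charged by `2·a_k` instead of `a_{k+1}·Td`:
`a₀·N_k + Σ_{1≤i<k} C(k,i)·Σ_{1≤l≤k−i} a_l·Mc[k,i,l] + Σ_{1≤l<k} a_l·Tt[k,l] + a_k·Tu[k] + 2·a_k + a_k·N0` (the `N_k` term only for `k ≥ 1`). -/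
def CutoffDefectTable.boundNR (T : CutoffDefectTable) (a : ℕ → ℝ) (k : ℕ) : ℝ :=
  (if 1 ≤ k then a 0 * T.N k else 0) +
    (∑ i ∈ Finset.Ico 1 k, (k.choose i : ℝ) * ∑ l ∈ Finset.Icc 1 (k - i), a l * T.Mc k i l) +
    (∑ l ∈ Finset.Ico 1 k, a l * T.Tt k l) + a k * T.Tu k + 2 * a k + a k * T.N0

/-- `T.boundNR a k = T.bound a k − a_{k+1}·Td + 2·a_k`. -/
theorem CutoffDefectTable.boundNR_eq_bound_sub_add (T : CutoffDefectTable) (a : ℕ → ℝ) (k : ℕ) :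
    T.boundNR a k = T.bound a k - a (k + 1) * T.Td + 2 * a k := by
  unfold CutoffDefectTable.boundNR CutoffDefectTable.bound
  ring

/-- `T.boundNR a k` does not read `a l` for `l > k`: two size tables agreeing up to `k` give the same value. -/
theorem CutoffDefectTable.boundNR_congr (T : CutoffDefectTable) {a b : ℕ → ℝ} {k : ℕ} (hab : ∀ l ≤ k, a l = b l) :
    T.boundNR a k = T.boundNR b k := by
  unfold CutoffDefectTable.boundNR
  have h0 : a 0 = b 0 := hab 0 (Nat.zero_le _)
  have hk : a k = b k := hab k le_rfl
  have hMc : ∑ i ∈ Finset.Ico 1 k, (k.choose i : ℝ) * ∑ l ∈ Finset.Icc 1 (k - i), a l * T.Mc k i l =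
      ∑ i ∈ Finset.Ico 1 k, (k.choose i : ℝ) * ∑ l ∈ Finset.Icc 1 (k - i), b l * T.Mc k i l := by
    refine Finset.sum_congr rfl fun i hi => ?_
    congr 1
    refine Finset.sum_congr rfl fun l hl => ?_
    simp only [Finset.mem_Icc] at hl
    rw [hab l (by omega)]
  have hTt : ∑ l ∈ Finset.Ico 1 k, a l * T.Tt k l = ∑ l ∈ Finset.Ico 1 k, b l * T.Tt k l := by
    refine Finset.sum_congr rfl fun l hl => ?_
    simp only [Finset.mem_Ico] at hl
    rw [hab l hl.2.le]
  rw [h0, hk, hMc, hTt]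

/-- The door's sum `Σ_{i<k} C(k,i+1)·Mx(i+1) + Tm + Em` with the certificate's majorant moments and the NO-RATE transport moment
`Σ_{l<k} a_l·Tt[k,l] + a_k·Tu[k] + 2·a_k` IS the linear form `T.boundNR a k` (`1 ≤ k ≤ 4`). -/
theorem door_sum_eq_boundNR (T : CutoffDefectTable) (a : ℕ → ℝ) {k : ℕ} (hk1 : 1 ≤ k) (hk : k ≤ 4) :
    (∑ i ∈ Finset.range k, ((k.choose (i + 1) : ℕ) : ℝ) *
        ((if i + 1 = k then a 0 * T.N (i + 1) else 0) + ∑ l ∈ Finset.Icc 1 (k - (i + 1)), a l * T.Mc k (i + 1) l)) +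
      ((∑ l ∈ Finset.Ico 1 k, a l * T.Tt k l) + a k * T.Tu k + 2 * a k) + a k * T.N0 = T.boundNR a k := by
  unfold CutoffDefectTable.boundNR
  interval_cases k
  · simp; ring
  · have e2 : Finset.Ico 1 2 = {1} := by decide
    simp [Finset.sum_range_succ, e2, Nat.choose]
    ring
  · have e1 : Finset.Icc 1 2 = {1, 2} := by decide
    have e3 : Finset.Ico 1 3 = {1, 2} := by decide
    simp [Finset.sum_range_succ, e1, e3, Nat.choose]
    ring
  · have e1 : Finset.Icc 1 3 = {1, 2, 3} := by decide
    have e2 : Finset.Icc 1 2 = {1, 2} := by decide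
    have e4 : Finset.Ico 1 4 = {1, 2, 3} := by decide
    simp [Finset.sum_range_succ, e1, e2, e4, Nat.choose, Finset.sum_insert]
    ring

/-- Nonnegativity of the no-rate linear form for nonnegative inputs. -/
theorem CutoffDefectTable.boundNR_nonneg (T : CutoffDefectTable) {a : ℕ → ℝ} (ha : ∀ l, 0 ≤ a l) (hN0 : 0 ≤ T.N0) (hN : ∀ i, 0 ≤ T.N i)
    (hMc : ∀ k i l, 0 ≤ T.Mc k i l) (hTt : ∀ k l, 0 ≤ T.Tt k l) (hTu : ∀ k, 0 ≤ T.Tu k) (k : ℕ) :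
    0 ≤ T.boundNR a k := by
  unfold CutoffDefectTable.boundNR
  have h1 : 0 ≤ (if 1 ≤ k then a 0 * T.N k else 0) := by split <;> [exact mul_nonneg (ha 0) (hN k); exact le_rfl]
  have h2 : 0 ≤ ∑ i ∈ Finset.Ico 1 k, (k.choose i : ℝ) * ∑ l ∈ Finset.Icc 1 (k - i), a l * T.Mc k i l :=
    Finset.sum_nonneg fun i _ => mul_nonneg (by positivity) (Finset.sum_nonneg fun l _ => mul_nonneg (ha l) (hMc k i l))
  have h3 : 0 ≤ ∑ l ∈ Finset.Ico 1 k, a l * T.Tt k l := Finset.sum_nonneg fun l _ => mul_nonneg (ha l) (hTt k l)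
  have h4 := mul_nonneg (ha k) (hTu k); have h5 := ha k; have h6 := mul_nonneg (ha k) hN0
  linarith

/-- **Monotone in the sizes** (nonnegative table): `a ≤ b` entrywise ⇒ `T.boundNR a k ≤ T.boundNR b k`. -/
theorem CutoffDefectTable.boundNR_mono (T : CutoffDefectTable) {a b : ℕ → ℝ} (hab : ∀ l, a l ≤ b l) (hN0 : 0 ≤ T.N0) (hN : ∀ i, 0 ≤ T.N i)
    (hMc : ∀ k i l, 0 ≤ T.Mc k i l) (hTt : ∀ k l, 0 ≤ T.Tt k l) (hTu : ∀ k, 0 ≤ T.Tu k) (k : ℕ) :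
    T.boundNR a k ≤ T.boundNR b k := by
  unfold CutoffDefectTable.boundNR
  have h1 : (if 1 ≤ k then a 0 * T.N k else 0) ≤ (if 1 ≤ k then b 0 * T.N k else 0) := by
    split <;> [exact mul_le_mul_of_nonneg_right (hab 0) (hN k); exact le_rfl]
  have h2 : ∑ i ∈ Finset.Ico 1 k, (k.choose i : ℝ) * ∑ l ∈ Finset.Icc 1 (k - i), a l * T.Mc k i l ≤
      ∑ i ∈ Finset.Ico 1 k, (k.choose i : ℝ) * ∑ l ∈ Finset.Icc 1 (k - i), b l * T.Mc k i l :=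
    Finset.sum_le_sum fun i _ => mul_le_mul_of_nonneg_left
      (Finset.sum_le_sum fun l _ => mul_le_mul_of_nonneg_right (hab l) (hMc k i l)) (by positivity)
  have h3 : ∑ l ∈ Finset.Ico 1 k, a l * T.Tt k l ≤ ∑ l ∈ Finset.Ico 1 k, b l * T.Tt k l :=
    Finset.sum_le_sum fun l _ => mul_le_mul_of_nonneg_right (hab l) (hTt k l)
  have h4 := mul_le_mul_of_nonneg_right (hab k) (hTu k); have h5 := hab k; have h6 := mul_le_mul_of_nonneg_right (hab k) hN0
  linarith

/-- **The same monotonicity for the rate form** `T.bound` (nonnegative table incl. `Td`). -/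
theorem CutoffDefectTable.bound_mono (T : CutoffDefectTable) {a b : ℕ → ℝ} (hab : ∀ l, a l ≤ b l) (hN0 : 0 ≤ T.N0) (hN : ∀ i, 0 ≤ T.N i)
    (hMc : ∀ k i l, 0 ≤ T.Mc k i l) (hTt : ∀ k l, 0 ≤ T.Tt k l) (hTu : ∀ k, 0 ≤ T.Tu k) (hTd : 0 ≤ T.Td) (k : ℕ) :
    T.bound a k ≤ T.bound b k := by
  unfold CutoffDefectTable.bound
  have h1 : (if 1 ≤ k then a 0 * T.N k else 0) ≤ (if 1 ≤ k then b 0 * T.N k else 0) := by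
    split <;> [exact mul_le_mul_of_nonneg_right (hab 0) (hN k); exact le_rfl]
  have h2 : ∑ i ∈ Finset.Ico 1 k, (k.choose i : ℝ) * ∑ l ∈ Finset.Icc 1 (k - i), a l * T.Mc k i l ≤
      ∑ i ∈ Finset.Ico 1 k, (k.choose i : ℝ) * ∑ l ∈ Finset.Icc 1 (k - i), b l * T.Mc k i l :=
    Finset.sum_le_sum fun i _ => mul_le_mul_of_nonneg_left
      (Finset.sum_le_sum fun l _ => mul_le_mul_of_nonneg_right (hab l) (hMc k i l)) (by positivity)
  have h3 : ∑ l ∈ Finset.Ico 1 k, a l * T.Tt k l ≤ ∑ l ∈ Finset.Ico 1 k, b l * T.Tt k l :=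
    Finset.sum_le_sum fun l _ => mul_le_mul_of_nonneg_right (hab l) (hTt k l)
  have h4 := mul_le_mul_of_nonneg_right (hab k) (hTu k); have h5 := mul_le_mul_of_nonneg_right (hab (k + 1)) hTd
  have h6 := mul_le_mul_of_nonneg_right (hab k) hN0
  linarith

end Summit.HubbardSuperconductivity.HubbardSuperconductivity.Theorems.KLRegimeSplit

end
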